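import Mathlib.LinearAlgebra.Matrix.PosDef
import Mathlib.LinearAlgebra.Matrix.Symmetric
import Mathlib.LinearAlgebra.Matrix.Notation
import Mathlib.Algebra.Order.Field.Basic
import Mathlib.Algebra.Order.Field.Rat
import Mathlib.Algebra.Star.Rat
import Mathlib.Algebra.BigOperators.Fin
import Mathlib.Algebra.BigOperators.Ring.Finset
import Mathlib.Data.Rat.Cast.Order
import Mathlib.Data.Rat.BigOperators
import Mathlib.Data.Real.Basic
import Mathlib.Data.Real.Star
import HarnessLib

/-!
# Rational PSD / PD certificates (Gram–`LDLᵀ` form), checkable by `decide +kernel`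

Compute-infrastructure file (unit `infra-psd-sos-lp-checker`). To certify that a RATIONAL
symmetric matrix `A : Matrix (Fin n) (Fin n) ℚ` is positive semidefinite one exhibits rational
weights `d : Fin m → ℚ`, `d ≥ 0`, and a rational matrix `B : Matrix (Fin m) (Fin n) ℚ` with
`A = Bᵀ · diag(d) · B`, i.e. `A i j = ∑ k, d k * B k i * B k j`. Every rational PSD matrix has
such a certificate with `m = n` and `B` unit upper-triangular (the `LDLᵀ` decomposition is
rational, Blekherman–Parrilo–Thomas 2012, App. A.1.2), and conversely any such `A` satisfies
`xᵀ A x = ∑ k, d k (B x)ₖ² ≥ 0` over every ordered field. The certificate predicate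
`IsGramCert A d B` is a finite conjunction of rational (in)equalities, so for numeral data it is
closed by `by decide +kernel` (`native_decide` remains the user's option for large `n`, under the
`--computational` regime); the soundness theorems below then deliver the quadratic-form
inequality over `ℝ` (any linearly ordered field `R`) and Mathlib's `Matrix.PosSemidef` for the
cast matrix `A.map Rat.cast`.

Positive definiteness is certified by a margin: `IsGramCertPD A ε d B` says `0 < ε` and
`A - ε • 1` has a Gram certificate; then `xᵀ A x ≥ ε ‖x‖² > 0` for `x ≠ 0` (`Matrix.PosDef`).

## API (namespace `Literature.Computation.Certificates.PSD`)

* `PSD.IsGramCert A d B` (decidable) and its consequences `IsGramCert.isSymm`,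
  `quadForm_eq` (`xᵀAx = ∑ k, d k (B x)ₖ²`), `quadForm_nonneg`, `quadForm_nonneg'`
  (the `x i * x j * A i j` arrangement), `dotProduct_mulVec_nonneg`, `posSemidef`
  (`(A.map (Rat.cast : ℚ → R)).PosSemidef`, e.g. `R = ℝ`), `posSemidef_rat` (`A.PosSemidef`).
* `PSD.IsGramCertPD A ε d B` (decidable), `IsGramCertPD.quadForm_ge` (`ε ∑ xᵢ² ≤ xᵀAx`),
  `quadForm_pos`, `posDef`.
* `PSD.IsDiagDominant M` (symmetric, `∑_{j≠i} |M i j| ≤ M i i`; decidable) with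
  `IsDiagDominant.quadForm_nonneg` (Gershgorin), and the ROUNDED certificate `PSD.IsGramCertDD A d B`
  (`d ≥ 0`, `gramResidual A d B` diagonally dominant) with `quadForm_nonneg/'`,
  `dotProduct_mulVec_nonneg`, `posSemidef`, `posSemidef_rat` — small-digit data from a rounded
  floating-point factor (appended 2026-08-16).
* Kernel-checked `example`s at the end (tests and usage templates; the certificate data are
  produced off-line, e.g. by an exact rational `LDLᵀ`).

## References

G. Blekherman, P. Parrilo, R. Thomas (eds.), *Semidefinite Optimization and Convex Algebraic
Geometry*, SIAM 2012: App. A.1.2 (the `LDLᵀ` decomposition is rational; congruence preserves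
semidefiniteness) and Thm 3.43 / Exercise 3.46 (rational Gram matrices).
[cite: BlekhermanParriloThomas2012, App. A.1.2]. H. Peyrl, P. Parrilo, *Computing sum of squares
decompositions with rational coefficients*, TCS 409 (2008) — the rounding/projection procedure
that produces such certificates in practice. Statement shape as in
`Literature.Analysis.ValidatedNumerics.Verifier`.

## Not here

No decomposition algorithm (certificates are computed off-line and only checked), no
eigenvalue / interval methods, no sparse or block formats (a block-diagonal certificate is just
a Gram certificate with a sparse `B`).
-/

namespace Literature.Computation.Certificates

namespace PSD

open Finset Matrix

variable {n m : ℕ}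
variable {R : Type*} [Field R] [LinearOrder R] [IsStrictOrderedRing R]

/-! ### Gram certificates of positive semidefiniteness -/

/-- **Gram (`LDLᵀ`-type) certificate** that the rational matrix `A` is positive semidefinite:
nonnegative rational weights `d` and a rational matrix `B` with `A i j = ∑ k, d k * B k i * B k j`,
i.e. `A = Bᵀ · diag(d) · B`. Decidable; meant to be discharged by `decide +kernel`.
[cite: BlekhermanParriloThomas2012, App. A.1.2] -/
def IsGramCert (A : Matrix (Fin n) (Fin n) ℚ) (d : Fin m → ℚ) (B : Matrix (Fin m) (Fin n) ℚ) :
    Prop :=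
  (∀ k, 0 ≤ d k) ∧ ∀ i j, A i j = ∑ k, d k * (B k i * B k j)

/-- Decidability of `IsGramCert` (a finite conjunction of rational (in)equalities). [folklore] -/
instance IsGramCert.instDecidable (A : Matrix (Fin n) (Fin n) ℚ) (d : Fin m → ℚ)
    (B : Matrix (Fin m) (Fin n) ℚ) : Decidable (IsGramCert A d B) :=
  inferInstanceAs (Decidable ((∀ k, 0 ≤ d k) ∧ ∀ i j, A i j = ∑ k, d k * (B k i * B k j)))

namespace IsGramCert

variable {A : Matrix (Fin n) (Fin n) ℚ} {d : Fin m → ℚ} {B : Matrix (Fin m) (Fin n) ℚ}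

/-- A matrix with a Gram certificate is symmetric. [folklore] -/
theorem isSymm (h : IsGramCert A d B) : A.IsSymm :=
  Matrix.IsSymm.ext fun i j => by
    rw [h.2 i j, h.2 j i]
    exact Finset.sum_congr rfl fun k _ => by ring

/-- A Gram certificate literally says `A = Bᵀ * diagonal d * B`. [folklore] -/
theorem eq_transpose_mul_diagonal_mul (h : IsGramCert A d B) : A = Bᵀ * Matrix.diagonal d * B := by
  ext i j
  rw [h.2 i j, Matrix.mul_apply]
  refine Finset.sum_congr rfl fun k _ => ?_
  rw [Matrix.mul_diagonal, Matrix.transpose_apply]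
  ring

/-- The cast entries of a Gram-certified matrix. [folklore] -/
theorem cast_apply (h : IsGramCert A d B) (i j : Fin n) :
    (A i j : R) = ∑ k, (d k : R) * ((B k i : R) * (B k j : R)) := by
  rw [h.2 i j]; push_cast; rfl

/-- **Completion of squares**: under a Gram certificate the quadratic form of `A` (entries cast
into any field `R`) is a nonnegative combination of squares of linear forms,
`xᵀ A x = ∑ k, d k * (∑ i, B k i * x i) ^ 2`. [cite: BlekhermanParriloThomas2012, App. A.1.2] -/
theorem quadForm_eq (h : IsGramCert A d B) (x : Fin n → R) :
    ∑ i, ∑ j, x i * (A i j : R) * x j = ∑ k, (d k : R) * (∑ i, (B k i : R) * x i) ^ 2 := by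
  calc ∑ i, ∑ j, x i * (A i j : R) * x j
      = ∑ i, ∑ j, ∑ k, (d k : R) * ((B k i : R) * x i) * ((B k j : R) * x j) := by
        refine Finset.sum_congr rfl fun i _ => Finset.sum_congr rfl fun j _ => ?_
        rw [h.cast_apply, Finset.mul_sum, Finset.sum_mul]
        exact Finset.sum_congr rfl fun k _ => by ring
    _ = ∑ i, ∑ k, ∑ j, (d k : R) * ((B k i : R) * x i) * ((B k j : R) * x j) :=
        Finset.sum_congr rfl fun _ _ => Finset.sum_comm
    _ = ∑ k, ∑ i, ∑ j, (d k : R) * ((B k i : R) * x i) * ((B k j : R) * x j) := Finset.sum_comm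
    _ = ∑ k, (d k : R) * (∑ i, (B k i : R) * x i) ^ 2 := by
        refine Finset.sum_congr rfl fun k _ => ?_
        rw [sq, Finset.sum_mul_sum, Finset.mul_sum]
        refine Finset.sum_congr rfl fun i _ => ?_
        rw [Finset.mul_sum]
        exact Finset.sum_congr rfl fun j _ => by ring

/-- **Soundness (quadratic form)**: a Gram certificate makes `∑ i, ∑ j, x i * A i j * x j ≥ 0` for
every vector `x` over any linearly ordered field. [cite: BlekhermanParriloThomas2012, App. A.1.2] -/
theorem quadForm_nonneg (h : IsGramCert A d B) (x : Fin n → R) :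
    0 ≤ ∑ i, ∑ j, x i * (A i j : R) * x j := by
  rw [h.quadForm_eq x]
  exact Finset.sum_nonneg fun k _ => mul_nonneg (by exact_mod_cast h.1 k) (sq_nonneg _)

/-- The same inequality in the arrangement `∑ i, ∑ j, x i * x j * A i j` (the shape of
positive-type / Bochner conditions such as `∑ i, ∑ j, w i * w j * f (dist (y i) (y j)) ≥ 0`).
[folklore] -/
theorem quadForm_nonneg' (h : IsGramCert A d B) (x : Fin n → R) :
    0 ≤ ∑ i, ∑ j, x i * x j * (A i j : R) := by
  convert h.quadForm_nonneg x using 2 with i _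
  exact Finset.sum_congr rfl fun j _ => by ring

/-- Soundness in Mathlib's `dotProduct`/`mulVec` vocabulary: `0 ≤ x ⬝ᵥ (A.map cast *ᵥ x)`.
[folklore] -/
theorem dotProduct_mulVec_nonneg (h : IsGramCert A d B) (x : Fin n → R) :
    0 ≤ x ⬝ᵥ (A.map (Rat.cast : ℚ → R) *ᵥ x) := by
  convert h.quadForm_nonneg x using 1
  simp only [dotProduct, Matrix.mulVec, Matrix.map_apply, Finset.mul_sum, mul_assoc]

/-- **Soundness (`Matrix.PosSemidef`)**: the cast matrix `A.map (Rat.cast : ℚ → R)` is positive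
semidefinite for every linearly ordered field `R` with trivial star, in particular `R = ℝ`.
[cite: BlekhermanParriloThomas2012, App. A.1.2] -/
theorem posSemidef [StarRing R] [TrivialStar R] (h : IsGramCert A d B) :
    (A.map (Rat.cast : ℚ → R)).PosSemidef :=
  Matrix.PosSemidef.of_dotProduct_mulVec_nonneg
    (Matrix.isHermitian_iff_isSymm.2 (h.isSymm.map _))
    fun x => by simpa only [star_trivial] using h.dotProduct_mulVec_nonneg x

/-- Soundness over `ℚ` itself: `A.PosSemidef`. [folklore] -/
theorem posSemidef_rat (h : IsGramCert A d B) : A.PosSemidef := by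
  simpa using (h.posSemidef (R := ℚ))

end IsGramCert

/-! ### Positive definiteness with a margin -/

/-- **Gram certificate of positive definiteness with margin `ε`**: `0 < ε` and `A - ε • 1` carries
a Gram certificate. Decidable; meant to be discharged by `decide +kernel`.
[cite: BlekhermanParriloThomas2012, App. A.1.2] -/
def IsGramCertPD (A : Matrix (Fin n) (Fin n) ℚ) (ε : ℚ) (d : Fin m → ℚ)
    (B : Matrix (Fin m) (Fin n) ℚ) : Prop :=
  0 < ε ∧ IsGramCert (A - ε • (1 : Matrix (Fin n) (Fin n) ℚ)) d B

/-- Decidability of `IsGramCertPD`. [folklore] -/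
instance IsGramCertPD.instDecidable (A : Matrix (Fin n) (Fin n) ℚ) (ε : ℚ) (d : Fin m → ℚ)
    (B : Matrix (Fin m) (Fin n) ℚ) : Decidable (IsGramCertPD A ε d B) :=
  inferInstanceAs (Decidable (0 < ε ∧ IsGramCert (A - ε • (1 : Matrix (Fin n) (Fin n) ℚ)) d B))

namespace IsGramCertPD

variable {A : Matrix (Fin n) (Fin n) ℚ} {ε : ℚ} {d : Fin m → ℚ} {B : Matrix (Fin m) (Fin n) ℚ}

/-- The quadratic form of `A - ε • 1` splits off `ε ∑ xᵢ²`. [folklore] -/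
theorem quadForm_sub_smul_one (A : Matrix (Fin n) (Fin n) ℚ) (ε : ℚ) (x : Fin n → R) :
    ∑ i, ∑ j, x i * (((A - ε • (1 : Matrix (Fin n) (Fin n) ℚ)) i j : ℚ) : R) * x j =
      ∑ i, ∑ j, x i * (A i j : R) * x j - (ε : R) * ∑ i, x i ^ 2 := by
  have hent : ∀ i j, (((A - ε • (1 : Matrix (Fin n) (Fin n) ℚ)) i j : ℚ) : R) =
      (A i j : R) - if i = j then (ε : R) else 0 := by
    intro i j
    rw [Matrix.sub_apply, Matrix.smul_apply, Matrix.one_apply, Rat.cast_sub]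
    split_ifs <;> simp
  simp_rw [hent, mul_sub, sub_mul, Finset.sum_sub_distrib, mul_ite, mul_zero, ite_mul, zero_mul,
    Finset.sum_ite_eq, Finset.mem_univ, if_true, Finset.mul_sum]
  congr 1
  exact Finset.sum_congr rfl fun i _ => by ring

/-- A PD certificate is symmetric data: `A.IsSymm`. [folklore] -/
theorem isSymm (h : IsGramCertPD A ε d B) : A.IsSymm := by
  have h1 : (A - ε • (1 : Matrix (Fin n) (Fin n) ℚ)).IsSymm := h.2.isSymm
  have h2 : (ε • (1 : Matrix (Fin n) (Fin n) ℚ)).IsSymm := (Matrix.isSymm_one).smul ε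
  simpa using h1.add h2

/-- **Margin bound**: `ε ∑ xᵢ² ≤ xᵀ A x`. [cite: BlekhermanParriloThomas2012, App. A.1.2] -/
theorem quadForm_ge (h : IsGramCertPD A ε d B) (x : Fin n → R) :
    (ε : R) * ∑ i, x i ^ 2 ≤ ∑ i, ∑ j, x i * (A i j : R) * x j := by
  have h1 := h.2.quadForm_nonneg x
  rw [quadForm_sub_smul_one] at h1
  linarith

/-- **Soundness (quadratic form)**: `xᵀ A x > 0` for `x ≠ 0`.
[cite: BlekhermanParriloThomas2012, App. A.1.2] -/
theorem quadForm_pos (h : IsGramCertPD A ε d B) {x : Fin n → R} (hx : x ≠ 0) :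
    0 < ∑ i, ∑ j, x i * (A i j : R) * x j := by
  obtain ⟨i, hi⟩ := Function.ne_iff.1 hx
  have hsq : 0 < ∑ j, x j ^ 2 :=
    lt_of_lt_of_le (sq_pos_iff.2 hi)
      (Finset.single_le_sum (fun j _ => sq_nonneg (x j)) (Finset.mem_univ i))
  have hε : (0 : R) < ε := by exact_mod_cast h.1
  exact lt_of_lt_of_le (mul_pos hε hsq) (h.quadForm_ge x)

/-- **Soundness (`Matrix.PosDef`)**: the cast matrix `A.map (Rat.cast : ℚ → R)` is positive
definite (`R` any linearly ordered field with trivial star, e.g. `ℝ`).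
[cite: BlekhermanParriloThomas2012, App. A.1.2] -/
theorem posDef [StarRing R] [TrivialStar R] (h : IsGramCertPD A ε d B) :
    (A.map (Rat.cast : ℚ → R)).PosDef :=
  Matrix.PosDef.of_dotProduct_mulVec_pos
    (Matrix.isHermitian_iff_isSymm.2 (h.isSymm.map _))
    fun x hx => by
      have := h.quadForm_pos (R := R) hx
      convert this using 1
      simp only [star_trivial, dotProduct, Matrix.mulVec, Matrix.map_apply, Finset.mul_sum,
        mul_assoc]

/-- Soundness over `ℚ` itself: `A.PosDef`. [folklore] -/
theorem posDef_rat (h : IsGramCertPD A ε d B) : A.PosDef := by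
  simpa using (h.posDef (R := ℚ))

end IsGramCertPD

/-! ### Tests / usage templates (kernel-checked) -/

/-- Test: the path-graph Laplacian-like matrix `[[2,-1,0],[-1,2,-1],[0,-1,2]]` is PSD over `ℝ`;
certificate = its rational `LDLᵀ` (`d = (2, 3/2, 4/3)`, `B = Lᵀ`). -/
example : ((!![2, -1, 0; -1, 2, -1; 0, -1, 2] : Matrix (Fin 3) (Fin 3) ℚ).map
    (Rat.cast : ℚ → ℝ)).PosSemidef := by
  refine IsGramCert.posSemidef (d := ![2, 3 / 2, 4 / 3])
    (B := !![1, -1 / 2, 0; 0, 1, -2 / 3; 0, 0, 1]) ?_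
  decide +kernel

/-- Test: the same matrix is positive DEFINITE with margin `1/2` (`A - ½·1 = LDLᵀ` with
`d = (3/2, 5/6, 3/10)`). -/
example : ((!![2, -1, 0; -1, 2, -1; 0, -1, 2] : Matrix (Fin 3) (Fin 3) ℚ).map
    (Rat.cast : ℚ → ℝ)).PosDef := by
  refine IsGramCertPD.posDef (ε := 1 / 2) (d := ![3 / 2, 5 / 6, 3 / 10])
    (B := !![1, -2 / 3, 0; 0, 1, -6 / 5; 0, 0, 1]) ?_
  decide +kernel

/-- Test: a singular PSD matrix with a rank-one certificate (`m = 1 < n = 2`), conclusion in the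
quadratic-form shape `∑ i, ∑ j, x i * x j * A i j ≥ 0`. -/
example (x : Fin 2 → ℝ) :
    0 ≤ ∑ i, ∑ j, x i * x j * (((!![1, 1; 1, 1] : Matrix (Fin 2) (Fin 2) ℚ) i j : ℚ) : ℝ) := by
  refine IsGramCert.quadForm_nonneg' (d := ![1]) (B := !![1, 1]) ?_ x
  decide +kernel

/-! ### Rounded certificates: Gram part plus a diagonally dominant residual

Exact `LDLᵀ` data have numerators / denominators of hundreds of digits already at `n = 40`; the
practical alternative (a floating-point Cholesky / `LDLᵀ` factor rounded to a few digits) leaves a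
small residual `R = A − Bᵀ·diag d·B`, which is certified positive semidefinite by SYMMETRIC
DIAGONAL DOMINANCE (`∑_{j≠i} |R i j| ≤ R i i`, Gershgorin). `IsGramCertDD A d B` packages
`d ≥ 0` and "`gramResidual A d B` is symmetric diagonally dominant"; it is decidable rational
arithmetic of the same cost `O(n² m)` as `IsGramCert`, with small numbers. -/

/-- **Symmetric diagonal dominance with nonnegative diagonal** of a rational matrix:
`R i j = R j i` and `∑_{j ≠ i} |R i j| ≤ R i i` for every row `i`. Decidable. [folklore] -/
def IsDiagDominant (M : Matrix (Fin n) (Fin n) ℚ) : Prop :=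
  (∀ i j, M i j = M j i) ∧ ∀ i, ∑ j ∈ Finset.univ.erase i, |M i j| ≤ M i i

/-- Decidability of `IsDiagDominant`. [folklore] -/
instance IsDiagDominant.instDecidable (M : Matrix (Fin n) (Fin n) ℚ) :
    Decidable (IsDiagDominant M) :=
  inferInstanceAs
    (Decidable ((∀ i j, M i j = M j i) ∧ ∀ i, ∑ j ∈ Finset.univ.erase i, |M i j| ≤ M i i))

/-- The elementary bound behind Gershgorin's argument: `-(|r| (a² + b²)) ≤ 2 a r b`.
[folklore] -/
theorem neg_abs_mul_add_sq_le (r a b : R) : -(|r| * (a ^ 2 + b ^ 2)) ≤ 2 * (a * r * b) := by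
  have h1 : -|a * r * b| ≤ a * r * b := neg_abs_le _
  have h2 : |a * r * b| = |r| * (|a| * |b|) := by rw [abs_mul, abs_mul]; ring
  have h3 : 2 * |a| * |b| ≤ |a| ^ 2 + |b| ^ 2 := two_mul_le_add_sq |a| |b|
  rw [sq_abs, sq_abs] at h3
  nlinarith [abs_nonneg r, h1, h2, h3]

/-- **A symmetric diagonally dominant rational matrix with nonnegative diagonal is positive
semidefinite** (quadratic-form version, entries cast into any linearly ordered field; Gershgorin).
[folklore] -/
theorem IsDiagDominant.quadForm_nonneg {M : Matrix (Fin n) (Fin n) ℚ} (h : IsDiagDominant M)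
    (x : Fin n → R) : 0 ≤ ∑ i, ∑ j, x i * (M i j : R) * x j := by
  obtain ⟨hs, hdd⟩ := h
  set U : Fin n → R := fun i => ∑ j ∈ Finset.univ.erase i, |(M i j : R)| * x i ^ 2 with hU
  set V : Fin n → R := fun i => ∑ j ∈ Finset.univ.erase i, |(M i j : R)| * x j ^ 2 with hV
  -- (1) row by row: twice the row sum dominates `2 Mᵢᵢ xᵢ² − (Uᵢ + Vᵢ)`
  have step1 : ∀ i, 2 * (M i i : R) * x i ^ 2 - (U i + V i) ≤ 2 * ∑ j, x i * (M i j : R) * x j := by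
    intro i
    rw [← Finset.add_sum_erase Finset.univ (fun j => x i * (M i j : R) * x j) (Finset.mem_univ i),
      mul_add, Finset.mul_sum]
    have hoff : -(U i + V i) ≤ ∑ j ∈ Finset.univ.erase i, 2 * (x i * (M i j : R) * x j) := by
      have hb : ∑ j ∈ Finset.univ.erase i, -(|(M i j : R)| * (x i ^ 2 + x j ^ 2)) ≤
          ∑ j ∈ Finset.univ.erase i, 2 * (x i * (M i j : R) * x j) :=
        Finset.sum_le_sum fun j _ => neg_abs_mul_add_sq_le (M i j : R) (x i) (x j)
      have he : ∑ j ∈ Finset.univ.erase i, -(|(M i j : R)| * (x i ^ 2 + x j ^ 2)) = -(U i + V i) := by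
        simp only [hU, hV]
        rw [Finset.sum_neg_distrib, ← Finset.sum_add_distrib]
        congr 1
        exact Finset.sum_congr rfl fun j _ => by ring
      rw [he] at hb
      exact hb
    have hdiag : 2 * (M i i : R) * x i ^ 2 = 2 * (x i * (M i i : R) * x i) := by ring
    linarith
  -- (2) the two halves of the off-diagonal bound agree, by symmetry of `M`
  have hsymm : ∑ i, V i = ∑ i, U i := by
    simp only [hU, hV]
    simp_rw [Finset.sum_erase_eq_sub (Finset.mem_univ _)]
    rw [Finset.sum_sub_distrib, Finset.sum_sub_distrib, Finset.sum_comm]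
    congr 1
    exact Finset.sum_congr rfl fun a _ => Finset.sum_congr rfl fun b _ => by rw [hs a b]
  -- (3) sum the rows and use diagonal dominance
  have hsum : ∑ i, (2 * (M i i : R) * x i ^ 2 - (U i + V i)) ≤
      ∑ i, 2 * ∑ j, x i * (M i j : R) * x j := Finset.sum_le_sum fun i _ => step1 i
  have hrw : ∑ i, (2 * (M i i : R) * x i ^ 2 - (U i + V i)) =
      2 * ∑ i, ((M i i : R) * x i ^ 2 - U i) := by
    rw [Finset.sum_sub_distrib, Finset.sum_add_distrib, hsymm]
    have h2D : ∑ i, 2 * (M i i : R) * x i ^ 2 = 2 * ∑ i, (M i i : R) * x i ^ 2 := by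
      rw [Finset.mul_sum]
      exact Finset.sum_congr rfl fun i _ => by ring
    rw [h2D, Finset.sum_sub_distrib]
    ring
  have hpos : 0 ≤ ∑ i, ((M i i : R) * x i ^ 2 - U i) := by
    refine Finset.sum_nonneg fun i _ => ?_
    have hi : ∑ j ∈ Finset.univ.erase i, |(M i j : R)| ≤ (M i i : R) := by
      have := hdd i
      exact_mod_cast this
    have hUi : U i = x i ^ 2 * ∑ j ∈ Finset.univ.erase i, |(M i j : R)| := by
      simp only [hU, Finset.mul_sum]
      exact Finset.sum_congr rfl fun j _ => by ring
    have := mul_le_mul_of_nonneg_left hi (sq_nonneg (x i))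
    rw [hUi]; linarith
  have h2Q : ∑ i, 2 * ∑ j, x i * (M i j : R) * x j = 2 * ∑ i, ∑ j, x i * (M i j : R) * x j := by
    rw [Finset.mul_sum]
  linarith

/-- The residual `A − Bᵀ·diag d·B` of an approximate Gram certificate. [folklore] -/
def gramResidual (A : Matrix (Fin n) (Fin n) ℚ) (d : Fin m → ℚ) (B : Matrix (Fin m) (Fin n) ℚ) :
    Matrix (Fin n) (Fin n) ℚ :=
  fun i j => A i j - ∑ k, d k * (B k i * B k j)

/-- **Rounded Gram certificate** of positive semidefiniteness: `d ≥ 0` and the residual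
`A − Bᵀ·diag d·B` is symmetric diagonally dominant with nonnegative diagonal. Decidable; meant to
be discharged by `decide +kernel` with SMALL rational data (`B`, `d` rounded floating-point
factors). [cite: BlekhermanParriloThomas2012, App. A.1.2] -/
def IsGramCertDD (A : Matrix (Fin n) (Fin n) ℚ) (d : Fin m → ℚ) (B : Matrix (Fin m) (Fin n) ℚ) :
    Prop :=
  (∀ k, 0 ≤ d k) ∧ IsDiagDominant (gramResidual A d B)

/-- Decidability of `IsGramCertDD`. [folklore] -/
instance IsGramCertDD.instDecidable (A : Matrix (Fin n) (Fin n) ℚ) (d : Fin m → ℚ)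
    (B : Matrix (Fin m) (Fin n) ℚ) : Decidable (IsGramCertDD A d B) :=
  inferInstanceAs (Decidable ((∀ k, 0 ≤ d k) ∧ IsDiagDominant (gramResidual A d B)))

namespace IsGramCertDD

variable {A : Matrix (Fin n) (Fin n) ℚ} {d : Fin m → ℚ} {B : Matrix (Fin m) (Fin n) ℚ}

/-- A matrix with a rounded Gram certificate is symmetric. [folklore] -/
theorem isSymm (h : IsGramCertDD A d B) : A.IsSymm :=
  Matrix.IsSymm.ext fun i j => by
    have h1 : gramResidual A d B j i = gramResidual A d B i j := h.2.1 j i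
    simp only [gramResidual] at h1
    have h2 : ∑ k, d k * (B k j * B k i) = ∑ k, d k * (B k i * B k j) :=
      Finset.sum_congr rfl fun k _ => by ring
    linarith

/-- **Soundness (quadratic form)** of rounded Gram certificates: `xᵀ A x = ∑ d (Bx)² + xᵀ R x ≥ 0`.
[cite: BlekhermanParriloThomas2012, App. A.1.2] -/
theorem quadForm_nonneg (h : IsGramCertDD A d B) (x : Fin n → R) :
    0 ≤ ∑ i, ∑ j, x i * (A i j : R) * x j := by
  have hG : IsGramCert (fun i j => ∑ k, d k * (B k i * B k j)) d B := ⟨h.1, fun i j => rfl⟩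
  have h1 : 0 ≤ ∑ i, ∑ j, x i * ((∑ k, d k * (B k i * B k j) : ℚ) : R) * x j :=
    hG.quadForm_nonneg x
  have h2 := h.2.quadForm_nonneg x
  have h3 : ∀ i j, (A i j : R) =
      ((∑ k, d k * (B k i * B k j) : ℚ) : R) + ((gramResidual A d B i j : ℚ) : R) := by
    intro i j
    rw [← Rat.cast_add]
    congr 1
    simp [gramResidual]
  simp_rw [h3, mul_add, add_mul, Finset.sum_add_distrib]
  exact add_nonneg h1 h2

/-- The `x i * x j * A i j` arrangement. [folklore] -/
theorem quadForm_nonneg' (h : IsGramCertDD A d B) (x : Fin n → R) :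
    0 ≤ ∑ i, ∑ j, x i * x j * (A i j : R) := by
  convert h.quadForm_nonneg x using 2 with i _
  exact Finset.sum_congr rfl fun j _ => by ring

/-- `0 ≤ x ⬝ᵥ (A.map cast *ᵥ x)`. [folklore] -/
theorem dotProduct_mulVec_nonneg (h : IsGramCertDD A d B) (x : Fin n → R) :
    0 ≤ x ⬝ᵥ (A.map (Rat.cast : ℚ → R) *ᵥ x) := by
  convert h.quadForm_nonneg x using 1
  simp only [dotProduct, Matrix.mulVec, Matrix.map_apply, Finset.mul_sum, mul_assoc]

/-- **Soundness (`Matrix.PosSemidef`)** of rounded Gram certificates, over any linearly ordered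
field with trivial star (e.g. `ℝ`). [cite: BlekhermanParriloThomas2012, App. A.1.2] -/
theorem posSemidef [StarRing R] [TrivialStar R] (h : IsGramCertDD A d B) :
    (A.map (Rat.cast : ℚ → R)).PosSemidef :=
  Matrix.PosSemidef.of_dotProduct_mulVec_nonneg
    (Matrix.isHermitian_iff_isSymm.2 (h.isSymm.map _))
    fun x => by simpa only [star_trivial] using h.dotProduct_mulVec_nonneg x

/-- Soundness over `ℚ` itself. [folklore] -/
theorem posSemidef_rat (h : IsGramCertDD A d B) : A.PosSemidef := by
  simpa using (h.posSemidef (R := ℚ))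

end IsGramCertDD

/-- Test (rounded certificate): `A = [[2,-1,0],[-1,2,-1],[0,-1,2]]` with the one-digit
approximate factor `B = [[1, -1/2, 0], [0, 1, -7/10], [0, 0, 1]]`, `d = (2, 7/5, 6/5)`; the
residual `A − Bᵀ·diag d·B = [[0, 0, 0], [0, 1/10, -1/50], [0, -1/50, 57/500]]` is diagonally
dominant, so `A` is PSD over `ℝ`. -/
example : ((!![2, -1, 0; -1, 2, -1; 0, -1, 2] : Matrix (Fin 3) (Fin 3) ℚ).map
    (Rat.cast : ℚ → ℝ)).PosSemidef := by
  refine IsGramCertDD.posSemidef (d := ![2, 7 / 5, 6 / 5])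
    (B := !![1, -1 / 2, 0; 0, 1, -7 / 10; 0, 0, 1]) ?_
  decide +kernel

/-! ### Introduction lemmas (for block-wise `decide`, see `Certificates/Blocks.lean`)

The certificate predicates are plain `def`s, so the anonymous constructor does not see through
them; these lemmas expose the conjuncts so that each can be its own (possibly block-split)
`decide +kernel` — the remedy when one monolithic `decide` exceeds the kernel's memory cap. -/

/-- Assemble an exact Gram certificate from its two conjuncts. [folklore] -/
theorem IsGramCert.intro {A : Matrix (Fin n) (Fin n) ℚ} {d : Fin m → ℚ} {B : Matrix (Fin m) (Fin n) ℚ}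
    (hd : ∀ k, 0 ≤ d k) (hA : ∀ i j, A i j = ∑ k, d k * (B k i * B k j)) : IsGramCert A d B :=
  ⟨hd, hA⟩

/-- Assemble diagonal dominance from symmetry and the row inequalities. [folklore] -/
theorem IsDiagDominant.intro {M : Matrix (Fin n) (Fin n) ℚ} (hs : ∀ i j, M i j = M j i)
    (hr : ∀ i, ∑ j ∈ Finset.univ.erase i, |M i j| ≤ M i i) : IsDiagDominant M :=
  ⟨hs, hr⟩

/-- Assemble a rounded Gram certificate from `d ≥ 0` and the dominance of the residual.
[folklore] -/
theorem IsGramCertDD.intro {A : Matrix (Fin n) (Fin n) ℚ} {d : Fin m → ℚ}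
    {B : Matrix (Fin m) (Fin n) ℚ} (hd : ∀ k, 0 ≤ d k)
    (hR : IsDiagDominant (gramResidual A d B)) : IsGramCertDD A d B :=
  ⟨hd, hR⟩

/-- An exact Gram certificate is a rounded one (zero residual). [folklore] -/
theorem IsGramCert.isGramCertDD {A : Matrix (Fin n) (Fin n) ℚ} {d : Fin m → ℚ}
    {B : Matrix (Fin m) (Fin n) ℚ} (h : IsGramCert A d B) : IsGramCertDD A d B := by
  refine ⟨h.1, ?_, ?_⟩
  · intro i j
    simp only [gramResidual, h.2 i j, h.2 j i, sub_self]
  · intro i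
    have h0 : ∀ j, gramResidual A d B i j = 0 := fun j => by simp [gramResidual, h.2 i j]
    simp [h0]

/-- Assemble a PD certificate from the margin and the Gram certificate of `A − ε•1`. [folklore] -/
theorem IsGramCertPD.intro {A : Matrix (Fin n) (Fin n) ℚ} {ε : ℚ} {d : Fin m → ℚ}
    {B : Matrix (Fin m) (Fin n) ℚ} (hε : 0 < ε)
    (h : IsGramCert (A - ε • (1 : Matrix (Fin n) (Fin n) ℚ)) d B) : IsGramCertPD A ε d B :=
  ⟨hε, h⟩

end PSD

end Literature.Computation.Certificates
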